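import Mathlib
import Summits.NavierStokesRegularity.NavierStokesRegularity.Theorems.FilamentSkeletonRssStadiumBaseMargin
import Summits.NavierStokesRegularity.NavierStokesRegularity.Theorems.FilamentSkeletonRssStadiumSourceHolomorphic

/-!
# The matched kernel is holomorphic IN THE SOURCE on the band-or-slope region around a target (`TangentSkeletonNearStraightL`,
# stmt-NavierStokesRegularity-23320, registered stub `stub_stripPropagation` — the `hrect`/`hconn` input of
# Theorems.StadiumContourFamily.plateau_connectors_eq, blueprint item R4 of `DIAG-addendum-contour-g2.md`)

For a fixed target `z` (with `n`-fold discs) the OPEN source region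
  `Ω(z) = {ζ ∈ S : n|Im ζ| < hs, |Re ζ − c| + n|Im ζ| < L + hs, ( |Im z − Im ζ| < δ  ∨  (r₀ < |Re z − Re ζ| ∧ |Im z − Im ζ| < m·r₀) )}`
(a horizontal band of half-height `δ` around the target's height — it contains the thin rectangle between two nearby plateau heights — union the sloped
region — it contains the two fixed connectors, at horizontal distance `> r₀ = 7h`) carries the principal branch: on the band by Theorems.StadiumBaseMargin,
on the sloped part by Theorems.StadiumContourPositivityAbs.pair_base_re_ge_slope_abs.  Hence `ζ ↦ K(z, ζ)` is holomorphic on `Ω(z)`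
(Theorems.StadiumSourceHolomorphic.differentiableOn_kernel_source): `kernel_source_differentiableOn_region`, with the positivity recorded separately
(`base_re_pos_on_region`).  HONEST FRAMING: a tool for a HYPOTHETICAL filament skeleton on the NEGATIVE side of a MODEL route; nothing here bears on
Navier–Stokes regularity or blow-up.  `--supports stmt-NavierStokesRegularity-23320`.
-/

set_option linter.dupNamespace false

noncomputable section

namespace Summit.NavierStokesRegularity.NavierStokesRegularity.Theorems.StadiumSourceRegion

open Set Metric
open scoped InnerProductSpace Matrix
open Summit.NavierStokesRegularity.NavierStokesRegularity.Theorems.StadiumContourPositivityAbs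
open Summit.NavierStokesRegularity.NavierStokesRegularity.Theorems.StadiumBaseMargin
open Summit.NavierStokesRegularity.NavierStokesRegularity.Theorems.StadiumSourceHolomorphic

/-- The band-or-slope source region of a target `z` is open. [folklore] -/
theorem isOpen_region (hs L cc n δ r₀ m : ℝ) (z : ℂ) :
    IsOpen {ζ : ℂ | (|ζ.im| < hs ∧ |ζ.re - cc| < L + hs) ∧ n * |ζ.im| < hs ∧ |ζ.re - cc| + n * |ζ.im| < L + hs ∧
      (|z.im - ζ.im| < δ ∨ (r₀ < |z.re - ζ.re| ∧ |z.im - ζ.im| < m * r₀))} := by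
  have cim : Continuous fun ζ : ℂ => ζ.im := Complex.continuous_im
  have cre : Continuous fun ζ : ℂ => ζ.re := Complex.continuous_re
  refine ((isOpen_lt (continuous_abs.comp cim) continuous_const).inter
    (isOpen_lt (continuous_abs.comp (cre.sub continuous_const)) continuous_const)).inter ?_
  refine (isOpen_lt (continuous_const.mul (continuous_abs.comp cim)) continuous_const).inter ?_
  refine (isOpen_lt ((continuous_abs.comp (cre.sub continuous_const)).add (continuous_const.mul (continuous_abs.comp cim)))
    continuous_const).inter ?_
  refine (isOpen_lt (continuous_abs.comp (continuous_const.sub cim)) continuous_const).union ?_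
  exact (isOpen_lt continuous_const (continuous_abs.comp (continuous_const.sub cre))).inter
    (isOpen_lt (continuous_abs.comp (continuous_const.sub cim)) continuous_const)

/-- **Principal branch on the band-or-slope region.** [folklore] -/
theorem base_re_pos_on_region {hs L cc M Rb n m r₀ δ κ Λ : ℝ} {F : ℂ → (Fin 3 → ℂ)} {G : ℂ → ℂ}
    (hF : DifferentiableOn ℂ F {z : ℂ | |z.im| < hs ∧ |z.re - cc| < L + hs})
    (hunit : ∀ w ∈ {z : ℂ | |z.im| < hs ∧ |z.re - cc| < L + hs}, ∑ i, (deriv F w i) ^ 2 = 1)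
    (hM : ∀ z ∈ {z : ℂ | |z.im| < hs ∧ |z.re - cc| < L + hs}, ‖deriv F z‖ ≤ M)
    {X : ℝ → EuclideanSpace ℝ (Fin 3)} (hX : Differentiable ℝ X) (hXu : ∀ τ, ‖deriv X τ‖ = 1)
    (hosc : ∀ τ σ, ‖deriv X τ - deriv X σ‖ ≤ Rb)
    (hFX : ∀ r : ℝ, (r : ℂ) ∈ {z : ℂ | |z.im| < hs ∧ |z.re - cc| < L + hs} →
      F r = fun i => ((⟪X r, EuclideanSpace.single i (1:ℝ)⟫_ℝ : ℝ) : ℂ))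
    (hGre : ∀ w ∈ {z : ℂ | |z.im| < hs ∧ |z.re - cc| < L + hs}, Λ⁻¹ / 2 ≤ (G w).re)
    (hn : 1 < n) (hκ : 0 < κ) (hΛ : 0 < Λ) {z : ℂ}
    (hzS : z ∈ {z : ℂ | |z.im| < hs ∧ |z.re - cc| < L + hs}) (hzfit : n * |z.im| < hs) (hzfit' : |z.re - cc| + n * |z.im| < L + hs)
    (hm0 : 0 ≤ m) (hm1 : m ≤ 1) (hr₀ : 0 < r₀) (hδm : δ ≤ m * r₀) (hsmall : 3 * M ^ 2 * (r₀ + δ) ^ 2 ≤ κ * Λ⁻¹ / 4)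
    (hA : 0 ≤ 1 - (Rb + 2 * (√3 * (2 * M * (Real.log (n / (n - 1)) - 1 / n)))) ^ 2 / 2)
    (hC : 0 < (1 - m ^ 2) * (1 - (Rb + 2 * (√3 * (2 * M * (Real.log (n / (n - 1)) - 1 / n)))) ^ 2 / 2) -
      2 * m * (2 * (√3 * (M * Real.log (n / (n - 1)))) * (Rb + 2 * (√3 * (2 * M * (Real.log (n / (n - 1)) - 1 / n))))))
    {ζ : ℂ} (hζ : ζ ∈ {ζ : ℂ | (|ζ.im| < hs ∧ |ζ.re - cc| < L + hs) ∧ n * |ζ.im| < hs ∧ |ζ.re - cc| + n * |ζ.im| < L + hs ∧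
      (|z.im - ζ.im| < δ ∨ (r₀ < |z.re - ζ.re| ∧ |z.im - ζ.im| < m * r₀))}) :
    0 < ((∑ i, (F z i - F ζ i) ^ 2) + (κ : ℂ) * G ζ).re := by
  obtain ⟨hζS, hζfit, hζfit', hcase⟩ := hζ
  set C : ℝ := (1 - m ^ 2) * (1 - (Rb + 2 * (√3 * (2 * M * (Real.log (n / (n - 1)) - 1 / n)))) ^ 2 / 2) -
      2 * m * (2 * (√3 * (M * Real.log (n / (n - 1)))) * (Rb + 2 * (√3 * (2 * M * (Real.log (n / (n - 1)) - 1 / n))))) with hCdef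
  rcases hcase with hband | ⟨hfar, hsl⟩
  · have h := base_re_margin hF hunit hM hX hXu hosc hFX hn hzS hζS hzfit hzfit' hζfit hζfit' hκ hΛ (hGre _ hζS)
      hm0 hm1 hr₀ hband.le hδm hsmall hA hC.le
    have hpos : 0 < min (κ * Λ⁻¹ / 4) (r₀ ^ 2 * C) := lt_min (by positivity) (by positivity)
    rw [← hCdef] at h
    exact lt_of_lt_of_le hpos h
  · have hslope : |z.im - ζ.im| ≤ m * |z.re - ζ.re| := hsl.le.trans (mul_le_mul_of_nonneg_left hfar.le hm0)
    have h := pair_base_re_ge_slope_abs hF hunit hM hX hXu hosc hFX hn hzfit hzfit' hζfit hζfit' hm0 hm1 hslope hA hκ.le (hGre _ hζS)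
    rw [← hCdef] at h
    have h1 : 0 < (z.re - ζ.re) ^ 2 * C := by
      have : 0 < |z.re - ζ.re| := hr₀.trans hfar
      have : 0 < (z.re - ζ.re) ^ 2 := by rw [← sq_abs]; positivity
      positivity
    have h2 : 0 ≤ κ * (Λ⁻¹ / 2) := by positivity
    linarith

/-- **The kernel is holomorphic in the source on the band-or-slope region.** [folklore] -/
theorem kernel_source_differentiableOn_region {hs L cc M Rb n m r₀ δ κ Λ : ℝ} {F : ℂ → (Fin 3 → ℂ)} {G : ℂ → ℂ}
    (hF : DifferentiableOn ℂ F {z : ℂ | |z.im| < hs ∧ |z.re - cc| < L + hs})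
    (hunit : ∀ w ∈ {z : ℂ | |z.im| < hs ∧ |z.re - cc| < L + hs}, ∑ i, (deriv F w i) ^ 2 = 1)
    (hM : ∀ z ∈ {z : ℂ | |z.im| < hs ∧ |z.re - cc| < L + hs}, ‖deriv F z‖ ≤ M)
    {X : ℝ → EuclideanSpace ℝ (Fin 3)} (hX : Differentiable ℝ X) (hXu : ∀ τ, ‖deriv X τ‖ = 1)
    (hosc : ∀ τ σ, ‖deriv X τ - deriv X σ‖ ≤ Rb)
    (hFX : ∀ r : ℝ, (r : ℂ) ∈ {z : ℂ | |z.im| < hs ∧ |z.re - cc| < L + hs} →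
      F r = fun i => ((⟪X r, EuclideanSpace.single i (1:ℝ)⟫_ℝ : ℝ) : ℂ))
    (hG : DifferentiableOn ℂ G {z : ℂ | |z.im| < hs ∧ |z.re - cc| < L + hs})
    (hGre : ∀ w ∈ {z : ℂ | |z.im| < hs ∧ |z.re - cc| < L + hs}, Λ⁻¹ / 2 ≤ (G w).re)
    (hn : 1 < n) (hκ : 0 < κ) (hΛ : 0 < Λ) {z : ℂ}
    (hzS : z ∈ {z : ℂ | |z.im| < hs ∧ |z.re - cc| < L + hs}) (hzfit : n * |z.im| < hs) (hzfit' : |z.re - cc| + n * |z.im| < L + hs)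
    (hm0 : 0 ≤ m) (hm1 : m ≤ 1) (hr₀ : 0 < r₀) (hδm : δ ≤ m * r₀) (hsmall : 3 * M ^ 2 * (r₀ + δ) ^ 2 ≤ κ * Λ⁻¹ / 4)
    (hA : 0 ≤ 1 - (Rb + 2 * (√3 * (2 * M * (Real.log (n / (n - 1)) - 1 / n)))) ^ 2 / 2)
    (hC : 0 < (1 - m ^ 2) * (1 - (Rb + 2 * (√3 * (2 * M * (Real.log (n / (n - 1)) - 1 / n)))) ^ 2 / 2) -
      2 * m * (2 * (√3 * (M * Real.log (n / (n - 1)))) * (Rb + 2 * (√3 * (2 * M * (Real.log (n / (n - 1)) - 1 / n)))))) :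
    DifferentiableOn ℂ (fun ζ => (((∑ i, (F z i - F ζ i) ^ 2) + (κ : ℂ) * G ζ) ^ ((3:ℂ) / 2))⁻¹ •
        (deriv F ζ ⨯₃ (fun i => F z i - F ζ i)))
      {ζ : ℂ | (|ζ.im| < hs ∧ |ζ.re - cc| < L + hs) ∧ n * |ζ.im| < hs ∧ |ζ.re - cc| + n * |ζ.im| < L + hs ∧
        (|z.im - ζ.im| < δ ∨ (r₀ < |z.re - ζ.re| ∧ |z.im - ζ.im| < m * r₀))} := by
  have hΩ := isOpen_region hs L cc n δ r₀ m z
  have hsub : {ζ : ℂ | (|ζ.im| < hs ∧ |ζ.re - cc| < L + hs) ∧ n * |ζ.im| < hs ∧ |ζ.re - cc| + n * |ζ.im| < L + hs ∧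
        (|z.im - ζ.im| < δ ∨ (r₀ < |z.re - ζ.re| ∧ |z.im - ζ.im| < m * r₀))} ⊆ {z : ℂ | |z.im| < hs ∧ |z.re - cc| < L + hs} :=
    fun ζ hζ => hζ.1
  exact differentiableOn_kernel_source hΩ (hF.mono hsub) (hG.mono hsub) z fun ζ hζ =>
    base_re_pos_on_region hF hunit hM hX hXu hosc hFX hGre hn hκ hΛ hzS hzfit hzfit' hm0 hm1 hr₀ hδm hsmall hA hC hζ

end Summit.NavierStokesRegularity.NavierStokesRegularity.Theorems.StadiumSourceRegion

end
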